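import Mathlib
import Literature.Analysis.Matrix.EigenvalueCountOnSubspaces
import Summits.ValiantsHypothesis.ValiantsHypothesis.Theorems.LacunarySymmetroidMatrixDescartesDefiniteMomentsZonesExact
import Summits.ValiantsHypothesis.ValiantsHypothesis.Theorems.LacunarySymmetroidMatrixDescartesDefiniteMomentsZonesClosure

/-!
# `MatrixDescartes` (stmt-ValiantsHypothesis-18050) — the DEFINITE-MOMENTS LAW, zones EXACT IV: THE INERTIA WALK COUNTS THE
# ROOTS on a directed window, and LACUNARY CAUCHY INTERLACING — on every window of the hyperbolic sector the roots of the
# determinant of a principal compression interlace those of `det F` (counting form)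

HONEST FRAMING.  Cell `pub-symmetroid`, seat `val-sym-mdr-p2` (gen 16); helper file `--supports` the crux
`Theses.LacunarySymmetroid.MatrixDescartes`, NO closure claim.  A sector law beside the crux (gen 15 successor item #3,
«interlacing under compression»); nothing here bears on the crux in its window, on `stub_twoSided`, on `DoorA26`/`DoorA34`,
registers, or `VP ≠ VNP`.

THEOREMS.  `F(x) = ∑ₖ x^{dₖ} Sₖ` real symmetric; a window `a < b` with `F(a) ≻ 0 ≻ F(b)` in which every Rayleigh form has at
most one zero (a window of gen 14's Theorem A / of the hyperbolic sector).  (1) `negIndex_eq_sum_corank_upTo`: for every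
scale `x ∈ (a, b]`, `ν(F(x)) = ∑_{roots t ∈ (a,x)} dim ker F(t)` — THE INERTIA WALK IS MONOTONE AND COUNTS THE ROOTS
(with kernel dimension; with multiplicity when the Rayleigh zeros are simple, `card_roots_upTo_eq_negIndex`); the mirror
orientation `F(a) ≺ 0 ≺ F(b)` and the packaging on the gaps of `K` alternating scales are the companion file
`…ZonesInterlacingGaps`.  (2) `sum_corank_upTo_interlace`: for an injective `e : κ → ι` and the
principal COMPRESSION `G(x) = F(x)[e,e]` (letters `Sₖ[e,e]`, again a window of the same kind), at every scale `x ∈ (a, b]`,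
`N_G(a,x) ≤ N_F(a,x) ≤ N_G(a,x) + (card ι − card κ)` where `N(a,x)` is the number of roots in `(a, x)`
weighted by kernel dimension — LACUNARY CAUCHY INTERLACING in counting form (static inclusion principle
`Literature…EigenvalueCountOnSubspaces.card_submatrix_eigenvalues_lt_le/_ge_le` at the scale `x`, transported by (1));
`card_roots_upTo_interlace` is the form with multiplicities under simple Rayleigh zeros. [folklore] (Markus 1988 §31;
Horn–Johnson Thm 4.3.28); axioms standard; no definitions.
-/

-- layout Summits/ValiantsHypothesis/ValiantsHypothesis forces the duplicated namespace component
set_option linter.dupNamespace false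

namespace Summit.ValiantsHypothesis.ValiantsHypothesis.Theorems.LacunarySymmetroidMatrixDescartes

open Polynomial Matrix Finset
open scoped BigOperators Topology

namespace DefiniteMoments

variable {ι : Type} [Fintype ι] [DecidableEq ι] {κ : Type} [Fintype κ]

/-! ## §1 The inertia walk counts the roots on a directed window -/

omit [DecidableEq ι] in
/-- Negativity propagates upward on a window `F(a) ≻ 0 ≻ F(b)` with one Rayleigh zero per form. [folklore] -/
theorem propagate_nonpos (d : κ → ℕ) (S : κ → Matrix ι ι ℝ) {a b : ℝ}
    (hFa : ∀ v : ι → ℝ, v ≠ 0 → 0 < v ⬝ᵥ ((∑ k, a ^ d k • S k) *ᵥ v))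
    (hFb : ∀ v : ι → ℝ, v ≠ 0 → v ⬝ᵥ ((∑ k, b ^ d k • S k) *ᵥ v) < 0)
    (hone : ∀ v : ι → ℝ, v ≠ 0 → ∀ r₁ r₂ : ℝ, a < r₁ → r₁ < b → a < r₂ → r₂ < b →
      v ⬝ᵥ ((∑ k, r₁ ^ d k • S k) *ᵥ v) = 0 → v ⬝ᵥ ((∑ k, r₂ ^ d k • S k) *ᵥ v) = 0 → r₁ = r₂)
    (v : ι → ℝ) (hv : v ≠ 0) (s t : ℝ) (has : a ≤ s) (hst : s < t) (htb : t ≤ b)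
    (hfs : v ⬝ᵥ ((fun x : ℝ => ∑ k, x ^ d k • S k) s *ᵥ v) ≤ 0) :
    v ⬝ᵥ ((fun x : ℝ => ∑ k, x ^ d k • S k) t *ᵥ v) < 0 := by
  rcases eq_or_lt_of_le htb with rfl | htb'
  · exact hFb v hv
  have has' : a < s := lt_of_le_of_ne has fun e => by
    rw [← e] at hfs; exact absurd (hFa v hv) (not_lt.2 hfs)
  by_contra hft
  push Not at hft
  have h := scalar_down (continuous_form d S v) (hFa v hv) (hFb v hv) (hone v hv) has' hst htb' hft
  exact absurd hfs (not_le.2 h)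

/-- **THE INERTIA WALK COUNTS THE ROOTS.**  On a window `a < b` with `F(a) ≻ 0 ≻ F(b)` and one Rayleigh zero per form, at
every scale `x ∈ (a, b]` (singular or not): `ν(F(x)) = ∑_{roots t ∈ (a, x)} dim ker F(t)`. [folklore] -/
theorem negIndex_eq_sum_corank_upTo (d : κ → ℕ) (S : κ → Matrix ι ι ℝ) (hS : ∀ k, (S k).IsSymm) {a b x : ℝ}
    (hax : a < x) (hxb : x ≤ b)
    (hFa : ∀ v : ι → ℝ, v ≠ 0 → 0 < v ⬝ᵥ ((∑ k, a ^ d k • S k) *ᵥ v))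
    (hFb : ∀ v : ι → ℝ, v ≠ 0 → v ⬝ᵥ ((∑ k, b ^ d k • S k) *ᵥ v) < 0)
    (hone : ∀ v : ι → ℝ, v ≠ 0 → ∀ r₁ r₂ : ℝ, a < r₁ → r₁ < b → a < r₂ → r₂ < b →
      v ⬝ᵥ ((∑ k, r₁ ^ d k • S k) *ᵥ v) = 0 → v ⬝ᵥ ((∑ k, r₂ ^ d k • S k) *ᵥ v) = 0 → r₁ = r₂) :
    Fintype.card {j // (Inertia.isHermitian_pencil d S hS x).eigenvalues j < 0}
      = ∑ t ∈ (Matrix.det (∑ k, ((X : ℝ[X]) ^ d k) • (S k).map C)).roots.toFinset.filter (fun t => a < t ∧ t < x),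
          (Fintype.card ι - (∑ k, t ^ d k • S k).rank) := by
  classical
  have hH := Inertia.isHermitian_pencil d S hS
  have hcont := Inertia.continuous_pencil_entry d S
  set P := Matrix.det (∑ k, ((X : ℝ[X]) ^ d k) • (S k).map C) with hP
  have hdetA : (∑ k, a ^ d k • S k).det ≠ 0 := det_ne_zero_of_form_ne_zero fun v hv h => by
    have := hFa v hv; rw [h] at this; exact lt_irrefl 0 this
  have hP0 : P ≠ 0 := fun h => hdetA (by
    have e := eval_det_pencil d S a
    rw [← hP, h, eval_zero] at e
    exact e.symm)
  set T := P.roots.toFinset with hT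
  have haT : a ∉ T := fun h => by
    rw [hT, Multiset.mem_toFinset, mem_roots hP0, IsRoot, hP, eval_det_pencil] at h
    exact hdetA h
  have hIco : T.filter (fun t => a ≤ t ∧ t < x) = T.filter (fun t => a < t ∧ t < x) :=
    Finset.filter_congr fun t ht =>
      ⟨fun h => ⟨lt_of_le_of_ne h.1 (fun e => haT (e ▸ ht)), h.2⟩, fun h => ⟨h.1.le, h.2⟩⟩
  obtain ⟨hνa, -, hra⟩ := indices_of_pos (hH a) hFa
  -- upper: the directed climb on `[a, x]`
  have hupper := negIndex_add_sum_corank_le_of_directed (fun x : ℝ => ∑ k, x ^ d k • S k) hH T _ a x hax le_rfl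
    (fun v hv s t has hst htx hfs => propagate_nonpos d S hFa hFb hone v hv s t has hst (le_trans htx hxb) hfs)
  -- lower: the jump bound on `[a, x]`
  have hlower := Inertia.negIndex_le_add_sum_corank (fun x : ℝ => ∑ k, x ^ d k • S k) hcont hH T hax.le
    (fun y _ hy => Inertia.mem_rootSet_of_det_eq_zero d S hP0 hy)
  rw [hIco] at hlower
  beta_reduce at hupper hlower hνa hra
  rw [hνa, hra] at hupper
  rw [hνa] at hlower
  omega

/-- **With multiplicity**: under simple Rayleigh zeros in the window, `ν(F(x))` is the number of roots of `det F` in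
`(a, x)` counted with multiplicity. [folklore] -/
theorem card_roots_upTo_eq_negIndex (d : κ → ℕ) (S : κ → Matrix ι ι ℝ) (hS : ∀ k, (S k).IsSymm) {a b x : ℝ}
    (hax : a < x) (hxb : x ≤ b)
    (hFa : ∀ v : ι → ℝ, v ≠ 0 → 0 < v ⬝ᵥ ((∑ k, a ^ d k • S k) *ᵥ v))
    (hFb : ∀ v : ι → ℝ, v ≠ 0 → v ⬝ᵥ ((∑ k, b ^ d k • S k) *ᵥ v) < 0)
    (hone : ∀ v : ι → ℝ, v ≠ 0 → ∀ r₁ r₂ : ℝ, a < r₁ → r₁ < b → a < r₂ → r₂ < b →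
      v ⬝ᵥ ((∑ k, r₁ ^ d k • S k) *ᵥ v) = 0 → v ⬝ᵥ ((∑ k, r₂ ^ d k • S k) *ᵥ v) = 0 → r₁ = r₂)
    (hsimple : ∀ v : ι → ℝ, v ≠ 0 → ∀ y : ℝ, a < y → y < b →
      v ⬝ᵥ ((∑ k, y ^ d k • S k) *ᵥ v) = 0 →
        (derivative (∑ k, C (v ⬝ᵥ (S k *ᵥ v)) * (X : ℝ[X]) ^ d k)).eval y ≠ 0) :
    Multiset.card ((Matrix.det (∑ k, ((X : ℝ[X]) ^ d k) • (S k).map C)).roots.filter (fun t => a < t ∧ t < x))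
      = Fintype.card {j // (Inertia.isHermitian_pencil d S hS x).eigenvalues j < 0} := by
  classical
  rw [negIndex_eq_sum_corank_upTo d S hS hax hxb hFa hFb hone, card_filter_eq_sum_count]
  refine Finset.sum_congr rfl fun t ht => ?_
  obtain ⟨-, hat, htx⟩ := Finset.mem_filter.1 ht
  rw [count_roots, rootMultiplicity_eq_corank_of_simple d S hS hsimple hat (lt_of_lt_of_le htx hxb)]

/-! ## §2 Principal compressions -/

section Compression

variable {κ' : Type} [Fintype κ'] [DecidableEq κ']

omit [Fintype ι] [DecidableEq ι] [Fintype κ'] [DecidableEq κ'] in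
/-- The compressed pencil evaluated: `G(x) = F(x)[e,e]`. [folklore] -/
theorem pencil_eval_submatrix (d : κ → ℕ) (S : κ → Matrix ι ι ℝ) (e : κ' → ι) (x : ℝ) :
    (∑ k, x ^ d k • (S k).submatrix e e) = (∑ k, x ^ d k • S k).submatrix e e := by
  ext i j
  simp [Matrix.sum_apply, Matrix.submatrix_apply, Matrix.smul_apply]

omit [DecidableEq κ'] in
/-- The Rayleigh forms of the compression are Rayleigh forms of `F` (at the zero-extension). [folklore] -/
theorem form_pencil_submatrix (d : κ → ℕ) (S : κ → Matrix ι ι ℝ) (e : κ' → ι) (he : Function.Injective e)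
    (u : κ' → ℝ) (x : ℝ) :
    u ⬝ᵥ ((∑ k, x ^ d k • (S k).submatrix e e) *ᵥ u)
      = (Function.extend e u 0) ⬝ᵥ ((∑ k, x ^ d k • S k) *ᵥ Function.extend e u 0) := by
  rw [pencil_eval_submatrix, form_submatrix _ e he]

omit [Fintype ι] [DecidableEq ι] [Fintype κ'] [DecidableEq κ'] [Fintype κ] in
/-- The zero-extension of a non-zero vector along an injection is non-zero. [folklore] -/
theorem extend_ne_zero {e : κ' → ι} (he : Function.Injective e) {u : κ' → ℝ} (hu : u ≠ 0) :
    Function.extend e u 0 ≠ 0 := by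
  intro h
  apply hu
  funext j
  have := congrFun h (e j)
  rwa [he.extend_apply] at this

/-- Negative indices of equal matrices agree (transport of the hermitian witness). [folklore] -/
theorem negIndex_congr {A B : Matrix κ' κ' ℝ} (hA : A.IsHermitian) (hB : B.IsHermitian) (h : A = B) :
    Fintype.card {j // hA.eigenvalues j < 0} = Fintype.card {j // hB.eigenvalues j < 0} := by
  subst h
  rfl

/-- **Static inclusion principle at a scale** (Horn–Johnson 4.3.28): `ν(G(x)) ≤ ν(F(x)) ≤ ν(G(x)) + (card ι − card κ')` for
the principal compression `G = F[e,e]`. [folklore] -/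
theorem negIndex_submatrix_interlace (d : κ → ℕ) (S : κ → Matrix ι ι ℝ) (hS : ∀ k, (S k).IsSymm) (e : κ' → ι)
    (he : Function.Injective e) (x : ℝ) :
    Fintype.card {j // (Inertia.isHermitian_pencil d (fun k => (S k).submatrix e e)
        (fun k => (hS k).submatrix e) x).eigenvalues j < 0}
      ≤ Fintype.card {i // (Inertia.isHermitian_pencil d S hS x).eigenvalues i < 0} ∧
    Fintype.card {i // (Inertia.isHermitian_pencil d S hS x).eigenvalues i < 0}
      ≤ Fintype.card {j // (Inertia.isHermitian_pencil d (fun k => (S k).submatrix e e)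
          (fun k => (hS k).submatrix e) x).eigenvalues j < 0} + (Fintype.card ι - Fintype.card κ') := by
  classical
  have hF := Inertia.isHermitian_pencil d S hS x
  have htr := negIndex_congr (Inertia.isHermitian_pencil d (fun k => (S k).submatrix e e) (fun k => (hS k).submatrix e) x)
    (hF.submatrix e) (pencil_eval_submatrix d S e x)
  rw [htr]
  have h1 := Literature.Analysis.Matrix.EigenvalueCountOnSubspaces.card_submatrix_eigenvalues_lt_le hF he 0
  have h2 := Literature.Analysis.Matrix.EigenvalueCountOnSubspaces.card_submatrix_eigenvalues_ge_le hF he 0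
  rw [← Fintype.card_subtype, ← Fintype.card_subtype] at h1 h2
  have c1 := Inertia.card_nonneg_eigs (hF.submatrix e)
  have c2 := Inertia.card_nonneg_eigs hF
  have l1 := Fintype.card_subtype_le fun j => (hF.submatrix e).eigenvalues j < 0
  have l2 := Fintype.card_subtype_le fun i => hF.eigenvalues i < 0
  have hκι : Fintype.card κ' ≤ Fintype.card ι := Fintype.card_le_of_injective e he
  refine ⟨h1, ?_⟩
  rw [c1, c2] at h2
  omega

/-- **LACUNARY CAUCHY INTERLACING (kernel-dimension form).**  On a window `a < b` with `F(a) ≻ 0 ≻ F(b)` and one Rayleigh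
zero per form, for a principal compression `G = F[e,e]` and every scale `x ∈ (a, b]`:
`N_G(a,x) ≤ N_F(a,x) ≤ N_G(a,x) + (card ι − card κ')`, `N` the number of roots in `(a, x)` weighted by kernel dimension.
[folklore] -/
theorem sum_corank_upTo_interlace (d : κ → ℕ) (S : κ → Matrix ι ι ℝ) (hS : ∀ k, (S k).IsSymm) (e : κ' → ι)
    (he : Function.Injective e) {a b x : ℝ} (hax : a < x) (hxb : x ≤ b)
    (hFa : ∀ v : ι → ℝ, v ≠ 0 → 0 < v ⬝ᵥ ((∑ k, a ^ d k • S k) *ᵥ v))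
    (hFb : ∀ v : ι → ℝ, v ≠ 0 → v ⬝ᵥ ((∑ k, b ^ d k • S k) *ᵥ v) < 0)
    (hone : ∀ v : ι → ℝ, v ≠ 0 → ∀ r₁ r₂ : ℝ, a < r₁ → r₁ < b → a < r₂ → r₂ < b →
      v ⬝ᵥ ((∑ k, r₁ ^ d k • S k) *ᵥ v) = 0 → v ⬝ᵥ ((∑ k, r₂ ^ d k • S k) *ᵥ v) = 0 → r₁ = r₂) :
    ∑ t ∈ (Matrix.det (∑ k, ((X : ℝ[X]) ^ d k) • ((S k).submatrix e e).map C)).roots.toFinset.filter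
        (fun t => a < t ∧ t < x), (Fintype.card κ' - (∑ k, t ^ d k • (S k).submatrix e e).rank)
      ≤ ∑ t ∈ (Matrix.det (∑ k, ((X : ℝ[X]) ^ d k) • (S k).map C)).roots.toFinset.filter (fun t => a < t ∧ t < x),
          (Fintype.card ι - (∑ k, t ^ d k • S k).rank) ∧
    ∑ t ∈ (Matrix.det (∑ k, ((X : ℝ[X]) ^ d k) • (S k).map C)).roots.toFinset.filter (fun t => a < t ∧ t < x),
        (Fintype.card ι - (∑ k, t ^ d k • S k).rank)
      ≤ ∑ t ∈ (Matrix.det (∑ k, ((X : ℝ[X]) ^ d k) • ((S k).submatrix e e).map C)).roots.toFinset.filter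
          (fun t => a < t ∧ t < x), (Fintype.card κ' - (∑ k, t ^ d k • (S k).submatrix e e).rank)
        + (Fintype.card ι - Fintype.card κ') := by
  have hS' : ∀ k, ((S k).submatrix e e).IsSymm := fun k => (hS k).submatrix e
  -- the compression is a window of the same kind
  have hGa : ∀ u : κ' → ℝ, u ≠ 0 → 0 < u ⬝ᵥ ((∑ k, a ^ d k • (S k).submatrix e e) *ᵥ u) := fun u hu => by
    rw [form_pencil_submatrix d S e he]; exact hFa _ (extend_ne_zero he hu)
  have hGb : ∀ u : κ' → ℝ, u ≠ 0 → u ⬝ᵥ ((∑ k, b ^ d k • (S k).submatrix e e) *ᵥ u) < 0 := fun u hu => by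
    rw [form_pencil_submatrix d S e he]; exact hFb _ (extend_ne_zero he hu)
  have honeG : ∀ u : κ' → ℝ, u ≠ 0 → ∀ r₁ r₂ : ℝ, a < r₁ → r₁ < b → a < r₂ → r₂ < b →
      u ⬝ᵥ ((∑ k, r₁ ^ d k • (S k).submatrix e e) *ᵥ u) = 0 →
        u ⬝ᵥ ((∑ k, r₂ ^ d k • (S k).submatrix e e) *ᵥ u) = 0 → r₁ = r₂ := by
    intro u hu r₁ r₂ h1 h2 h3 h4 hf1 hf2
    rw [form_pencil_submatrix d S e he] at hf1 hf2
    exact hone _ (extend_ne_zero he hu) r₁ r₂ h1 h2 h3 h4 hf1 hf2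
  rw [← negIndex_eq_sum_corank_upTo d S hS hax hxb hFa hFb hone,
    ← negIndex_eq_sum_corank_upTo d (fun k => (S k).submatrix e e) hS' hax hxb hGa hGb honeG]
  exact negIndex_submatrix_interlace d S hS e he x

/-- **LACUNARY CAUCHY INTERLACING (with multiplicity).**  Under simple Rayleigh zeros in the window, the numbers of roots
of `det F[e,e]` and of `det F` in `(a, x)` counted with multiplicity satisfy `N_G ≤ N_F ≤ N_G + (card ι − card κ')` at every
scale `x ∈ (a, b]`. [folklore] -/
theorem card_roots_upTo_interlace (d : κ → ℕ) (S : κ → Matrix ι ι ℝ) (hS : ∀ k, (S k).IsSymm) (e : κ' → ι)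
    (he : Function.Injective e) {a b x : ℝ} (hax : a < x) (hxb : x ≤ b)
    (hFa : ∀ v : ι → ℝ, v ≠ 0 → 0 < v ⬝ᵥ ((∑ k, a ^ d k • S k) *ᵥ v))
    (hFb : ∀ v : ι → ℝ, v ≠ 0 → v ⬝ᵥ ((∑ k, b ^ d k • S k) *ᵥ v) < 0)
    (hone : ∀ v : ι → ℝ, v ≠ 0 → ∀ r₁ r₂ : ℝ, a < r₁ → r₁ < b → a < r₂ → r₂ < b →
      v ⬝ᵥ ((∑ k, r₁ ^ d k • S k) *ᵥ v) = 0 → v ⬝ᵥ ((∑ k, r₂ ^ d k • S k) *ᵥ v) = 0 → r₁ = r₂)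
    (hsimple : ∀ v : ι → ℝ, v ≠ 0 → ∀ y : ℝ, a < y → y < b →
      v ⬝ᵥ ((∑ k, y ^ d k • S k) *ᵥ v) = 0 →
        (derivative (∑ k, C (v ⬝ᵥ (S k *ᵥ v)) * (X : ℝ[X]) ^ d k)).eval y ≠ 0) :
    Multiset.card ((Matrix.det (∑ k, ((X : ℝ[X]) ^ d k) • ((S k).submatrix e e).map C)).roots.filter
        (fun t => a < t ∧ t < x))
      ≤ Multiset.card ((Matrix.det (∑ k, ((X : ℝ[X]) ^ d k) • (S k).map C)).roots.filter (fun t => a < t ∧ t < x)) ∧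
    Multiset.card ((Matrix.det (∑ k, ((X : ℝ[X]) ^ d k) • (S k).map C)).roots.filter (fun t => a < t ∧ t < x))
      ≤ Multiset.card ((Matrix.det (∑ k, ((X : ℝ[X]) ^ d k) • ((S k).submatrix e e).map C)).roots.filter
          (fun t => a < t ∧ t < x)) + (Fintype.card ι - Fintype.card κ') := by
  have hS' : ∀ k, ((S k).submatrix e e).IsSymm := fun k => (hS k).submatrix e
  have hGa : ∀ u : κ' → ℝ, u ≠ 0 → 0 < u ⬝ᵥ ((∑ k, a ^ d k • (S k).submatrix e e) *ᵥ u) := fun u hu => by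
    rw [form_pencil_submatrix d S e he]; exact hFa _ (extend_ne_zero he hu)
  have hGb : ∀ u : κ' → ℝ, u ≠ 0 → u ⬝ᵥ ((∑ k, b ^ d k • (S k).submatrix e e) *ᵥ u) < 0 := fun u hu => by
    rw [form_pencil_submatrix d S e he]; exact hFb _ (extend_ne_zero he hu)
  have honeG : ∀ u : κ' → ℝ, u ≠ 0 → ∀ r₁ r₂ : ℝ, a < r₁ → r₁ < b → a < r₂ → r₂ < b →
      u ⬝ᵥ ((∑ k, r₁ ^ d k • (S k).submatrix e e) *ᵥ u) = 0 →
        u ⬝ᵥ ((∑ k, r₂ ^ d k • (S k).submatrix e e) *ᵥ u) = 0 → r₁ = r₂ := by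
    intro u hu r₁ r₂ h1 h2 h3 h4 hf1 hf2
    rw [form_pencil_submatrix d S e he] at hf1 hf2
    exact hone _ (extend_ne_zero he hu) r₁ r₂ h1 h2 h3 h4 hf1 hf2
  have hsimpleG : ∀ u : κ' → ℝ, u ≠ 0 → ∀ y : ℝ, a < y → y < b →
      u ⬝ᵥ ((∑ k, y ^ d k • (S k).submatrix e e) *ᵥ u) = 0 →
        (derivative (∑ k, C (u ⬝ᵥ ((S k).submatrix e e *ᵥ u)) * (X : ℝ[X]) ^ d k)).eval y ≠ 0 := by
    intro u hu y h1 h2 hf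
    rw [form_pencil_submatrix d S e he] at hf
    have h := hsimple _ (extend_ne_zero he hu) y h1 h2 hf
    have e' : (∑ k, C (u ⬝ᵥ ((S k).submatrix e e *ᵥ u)) * (X : ℝ[X]) ^ d k)
        = ∑ k, C (Function.extend e u 0 ⬝ᵥ (S k *ᵥ Function.extend e u 0)) * (X : ℝ[X]) ^ d k :=
      Finset.sum_congr rfl fun k _ => by rw [form_submatrix _ e he]
    rw [e']
    exact h
  rw [card_roots_upTo_eq_negIndex d S hS hax hxb hFa hFb hone hsimple,
    card_roots_upTo_eq_negIndex d (fun k => (S k).submatrix e e) hS' hax hxb hGa hGb honeG hsimpleG]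
  exact negIndex_submatrix_interlace d S hS e he x

end Compression

end DefiniteMoments

end Summit.ValiantsHypothesis.ValiantsHypothesis.Theorems.LacunarySymmetroidMatrixDescartes
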